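import Summits.Ventures.Crystal3D.Theorems.StickyWulffConstantNoReconstructionGainCapCount
import HarnessLib

/-!
# Cap accounting in an arbitrary REGISTRATION FRAME (parametric star `U`, cap threshold `c`)

HONEST FRAMING. Part of the venture `Summits/Ventures/Crystal3D` (cell `crystal3d-full`), helper
`--supports` the crux `NoReconstructionGain` (stmt-Ventures-19144, route
`route-Ventures-StickyWulffConstant`), line `adhesion` (wulff-p1 g10).  `…CapLocal` / `…CapCount` used
the fcc bond star (`|U| = 12`, caps of `30°`).  Nothing in the per-ball accounting needs the lattice:
it needs a finite set `U` of unit vectors closed under negation, a threshold `c ≥ √3/2` (so that two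
contacts in one cap `{⟪· − q, d⟫ > c}` would be `< 1` apart — `capPartner_unique`), and pairwise
`⟪d, d'⟫ ≤ 2c² − 1` on `U` (so that the caps are disjoint — `frameDir_unique`).  The identity then holds
with `|U|` in place of `12`:

* `real_inner_gt_of_caps` — unit `u` with `⟪u,d⟫, ⟪u,d'⟫ > c ≥ 0` forces `⟪d, d'⟫ > 2c² − 1`;
* `frameDir_unique` — hence a contact is registered to at most one direction of such a `U`;
* `perBall_frameAccount_eq` — the per-ball identity of `…CapCount` verbatim with `(U, c)`:
  `2·#plug + #film + Σ t = |U| + 2·(interstitial below) + (interstitial level) − 2·(vacant down caps)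
  − (vacant level caps) + 2·(plug in up-caps) + (plug in level caps)`.

Frames of interest: the fcc star (`|U| = 12`, `c = √3/2`: the landed theory); the 18-direction star of
a Barlow bilayer pair (fcc star ∪ twin star, minimum angle `33.56°`, `c = cos 16.78°`), in which EVERY
bond of EVERY Barlow stacking with that basal plane is registered — the frame for one-plate adhesion on
Barlow substrates (T line, `stub_barlowAdhesionR`); the icosahedral star.

WHAT THIS IS NOT: any statement about a substrate (rim lemmas are frame- and substrate-specific);
rung F-C1 not moved.
-/

noncomputable section

namespace Summit.Ventures.Crystal3D.Theorems

open Summit.Ventures.Crystal3D Finset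
open scoped InnerProductSpace

/-- **Two caps sharing a unit vector have close centres.**  If `‖u‖ = ‖d‖ = ‖d'‖ = 1`, `0 ≤ c`,
`⟪u, d⟫ > c` and `⟪u, d'⟫ > c`, then `⟪d, d'⟫ > 2c² − 1`. -/
theorem real_inner_gt_of_caps {u d d' : EuclideanSpace ℝ (Fin 3)} {c : ℝ} (hc : 0 ≤ c) (hu : ‖u‖ = 1)
    (hd : ‖d‖ = 1) (hd' : ‖d'‖ = 1) (hud : c < ⟪u, d⟫_ℝ) (hud' : c < ⟪u, d'⟫_ℝ) :
    2 * c ^ 2 - 1 < ⟪d, d'⟫_ℝ := by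
  set a := ⟪d, u⟫_ℝ with ha
  set b := ⟪d', u⟫_ℝ with hb
  have hau : c < a := by rw [ha, real_inner_comm]; exact hud
  have hbu : c < b := by rw [hb, real_inner_comm]; exact hud'
  have ha1 : a ≤ 1 := by
    have := abs_real_inner_le_norm d u; rw [hu, hd] at this; exact (abs_le.1 (by linarith)).2
  have hb1 : b ≤ 1 := by
    have := abs_real_inner_le_norm d' u; rw [hu, hd'] at this; exact (abs_le.1 (by linarith)).2
  set x := d - a • u with hx
  set y := d' - b • u with hy
  have huu : ⟪u, u⟫_ℝ = 1 := by rw [real_inner_self_eq_norm_sq, hu, one_pow]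
  have hx2 : ‖x‖ ^ 2 = 1 - a ^ 2 := by
    rw [hx, norm_sub_sq_real, hd, norm_smul, Real.norm_eq_abs, hu, mul_one, sq_abs, inner_smul_right,
      ← ha]; ring
  have hy2 : ‖y‖ ^ 2 = 1 - b ^ 2 := by
    rw [hy, norm_sub_sq_real, hd', norm_smul, Real.norm_eq_abs, hu, mul_one, sq_abs, inner_smul_right,
      ← hb]; ring
  have hxy : ⟪x, y⟫_ℝ = ⟪d, d'⟫_ℝ - a * b := by
    rw [hx, hy, inner_sub_left, inner_sub_right, inner_sub_right, inner_smul_left, inner_smul_right,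
      inner_smul_left, inner_smul_right, real_inner_comm d' u, ← hb, ← ha, huu]
    simp only [conj_trivial]; ring
  have hcs : |⟪x, y⟫_ℝ| ≤ ‖x‖ * ‖y‖ := abs_real_inner_le_norm x y
  -- `‖x‖ ‖y‖ ≤ 1 - c²` strictly unless both vanish; use squares
  have hxx : ‖x‖ ^ 2 < 1 - c ^ 2 := by nlinarith
  have hyy : ‖y‖ ^ 2 < 1 - c ^ 2 := by nlinarith
  have hprod : ‖x‖ * ‖y‖ < 1 - c ^ 2 := by
    have h0x := norm_nonneg x; have h0y := norm_nonneg y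
    by_contra hge
    push Not at hge
    have : (1 - c ^ 2) ^ 2 ≤ (‖x‖ * ‖y‖) ^ 2 := by
      have h1c : 0 ≤ 1 - c ^ 2 := by nlinarith
      exact pow_le_pow_left₀ h1c hge 2
    nlinarith [mul_nonneg (sq_nonneg ‖x‖) (sq_nonneg ‖y‖)]
  have hab : c ^ 2 < a * b := by nlinarith
  linarith [(abs_le.1 (le_trans hcs le_rfl)).1]

/-- **A contact is registered to at most one direction of a separated frame.** -/
theorem frameDir_unique (c : ℝ) (hc3 : Real.sqrt 3 / 2 ≤ c) {q x d d' : EuclideanSpace ℝ (Fin 3)}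
    (hx : dist q x = 1) (hd : ‖d‖ = 1) (hd' : ‖d'‖ = 1) (hsep : d ≠ d' → ⟪d, d'⟫_ℝ ≤ 2 * c ^ 2 - 1)
    (hxd : c < ⟪x - q, d⟫_ℝ) (hxd' : c < ⟪x - q, d'⟫_ℝ) : d = d' := by
  by_contra hne
  have hu : ‖x - q‖ = 1 := by rw [← dist_eq_norm, dist_comm, hx]
  have hc0 : 0 ≤ c := le_trans (by positivity) hc3
  have h := real_inner_gt_of_caps hc0 hu hd hd' hxd hxd'
  linarith [hsep hne]

/-- **Per-ball accounting in an arbitrary separated frame** (see the module docstring). -/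
theorem perBall_frameAccount_eq (X P : Finset (EuclideanSpace ℝ (Fin 3)))
    (hX : ∀ p ∈ X, ∀ q ∈ X, p ≠ q → 1 ≤ dist p q) (hPX : P ⊆ X)
    (U : Finset (EuclideanSpace ℝ (Fin 3))) (c : ℝ) (hc3 : Real.sqrt 3 / 2 ≤ c)
    (hU1 : ∀ d ∈ U, ‖d‖ = 1) (hUsep : ∀ d ∈ U, ∀ d' ∈ U, d ≠ d' → ⟪d, d'⟫_ℝ ≤ 2 * c ^ 2 - 1)
    (hUneg : ∀ d ∈ U, -d ∈ U) (ν : EuclideanSpace ℝ (Fin 3)) (q : EuclideanSpace ℝ (Fin 3)) (hq : q ∈ X \ P) :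
    2 * ((P.filter fun p => dist q p = 1).card : ℤ) + (((X \ P).filter fun x => dist q x = 1).card : ℤ)
      + ∑ x ∈ (X \ P).filter (fun x => dist q x = 1),
          (((if ∃ d ∈ U, ⟪d, ν⟫_ℝ < 0 ∧ c < ⟪x - q, d⟫_ℝ then (1 : ℤ) else 0)
            + (if (∀ d ∈ U, ⟪x - q, d⟫_ℝ ≤ c) ∧ ⟪x, ν⟫_ℝ < ⟪q, ν⟫_ℝ then (1 : ℤ) else 0))
          - ((if ∃ d ∈ U, ⟪d, ν⟫_ℝ < 0 ∧ c < ⟪q - x, d⟫_ℝ then (1 : ℤ) else 0)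
            + (if (∀ d ∈ U, ⟪q - x, d⟫_ℝ ≤ c) ∧ ⟪q, ν⟫_ℝ < ⟪x, ν⟫_ℝ then (1 : ℤ) else 0)))
    = (U.card : ℤ) + 2 * ((P.filter fun p => dist q p = 1 ∧ ∀ d ∈ U, ⟪p - q, d⟫_ℝ ≤ c).card : ℤ)
      + 2 * (((X \ P).filter fun x => dist q x = 1 ∧ (∀ d ∈ U, ⟪x - q, d⟫_ℝ ≤ c) ∧
          ⟪x, ν⟫_ℝ < ⟪q, ν⟫_ℝ).card : ℤ)
      + (((X \ P).filter fun x => dist q x = 1 ∧ (∀ d ∈ U, ⟪x - q, d⟫_ℝ ≤ c) ∧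
          ⟪x, ν⟫_ℝ = ⟪q, ν⟫_ℝ).card : ℤ)
      - 2 * ((U.filter fun d => ⟪d, ν⟫_ℝ < 0 ∧ ∀ x ∈ X, dist q x = 1 → ⟪x - q, d⟫_ℝ ≤ c).card : ℤ)
      - ((U.filter fun d => ⟪d, ν⟫_ℝ = 0 ∧ ∀ x ∈ X, dist q x = 1 → ⟪x - q, d⟫_ℝ ≤ c).card : ℤ)
      + 2 * ((U.filter fun d => 0 < ⟪d, ν⟫_ℝ ∧ ∃ p ∈ P, dist q p = 1 ∧ c < ⟪p - q, d⟫_ℝ).card : ℤ)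
      + ((U.filter fun d => ⟪d, ν⟫_ℝ = 0 ∧ ∃ p ∈ P, dist q p = 1 ∧ c < ⟪p - q, d⟫_ℝ).card : ℤ) := by
  classical
  set NP := P.filter fun p => dist q p = 1 with hNP
  set NF := (X \ P).filter fun x => dist q x = 1 with hNF
  -- occupancy predicates for a cap `d`
  set oP : EuclideanSpace ℝ (Fin 3) → Prop := fun d => ∃ p ∈ NP, c < ⟪p - q, d⟫_ℝ with hoP
  set oF : EuclideanSpace ℝ (Fin 3) → Prop := fun d => ∃ x ∈ NF, c < ⟪x - q, d⟫_ℝ with hoF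
  set vc : EuclideanSpace ℝ (Fin 3) → Prop := fun d => ∀ x ∈ X, dist q x = 1 → ⟪x - q, d⟫_ℝ ≤ c with hvc
  have hqX : q ∈ X := (mem_sdiff.1 hq).1
  have hqP : q ∉ P := (mem_sdiff.1 hq).2
  have hNPX : ∀ p ∈ NP, p ∈ X ∧ dist q p = 1 := fun p hp =>
    ⟨hPX (mem_filter.1 hp).1, (mem_filter.1 hp).2⟩
  have hNFX : ∀ x ∈ NF, x ∈ X ∧ dist q x = 1 := fun x hx =>
    ⟨(mem_sdiff.1 (mem_filter.1 hx).1).1, (mem_filter.1 hx).2⟩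
  -- (1) exclusivity / exhaustivity of the three occupancy states
  have hexcl : ∀ d ∈ U, ¬ (oP d ∧ oF d) := by
    rintro d hd ⟨⟨p, hp, hpd⟩, ⟨x, hx, hxd⟩⟩
    have := capPartner_unique X hX (hNPX p hp).1 (hNFX x hx).1 (hNPX p hp).2 (hNFX x hx).2 (hU1 d hd)
      (lt_of_le_of_lt hc3 hpd) (lt_of_le_of_lt hc3 hxd)
    exact (mem_sdiff.1 (mem_filter.1 hx).1).2 (this ▸ (mem_filter.1 hp).1)
  have hvc_iff : ∀ d ∈ U, vc d ↔ ¬ (oP d ∨ oF d) := by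
    intro d hd
    constructor
    · rintro h (⟨p, hp, hpd⟩ | ⟨x, hx, hxd⟩)
      · exact absurd (h p (hNPX p hp).1 (hNPX p hp).2) (not_le.2 hpd)
      · exact absurd (h x (hNFX x hx).1 (hNFX x hx).2) (not_le.2 hxd)
    · intro h x hxX hqx
      by_contra hle
      have hlt : c < ⟪x - q, d⟫_ℝ := lt_of_not_ge hle
      by_cases hxP : x ∈ P
      · exact h (Or.inl ⟨x, mem_filter.2 ⟨hxP, hqx⟩, hlt⟩)
      · exact h (Or.inr ⟨x, mem_filter.2 ⟨mem_sdiff.2 ⟨hxX, hxP⟩, hqx⟩, hlt⟩)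
  -- the three-way split of any `S ⊆ U`
  have hsplit : ∀ S : Finset (EuclideanSpace ℝ (Fin 3)), S ⊆ U →
      (S.card : ℤ) = (S.filter oP).card + (S.filter oF).card + (S.filter vc).card := by
    intro S hS
    have h1 := card_filter_add_card_filter_not (s := S) (fun d => oP d ∨ oF d)
    have h2 : (S.filter fun d => oP d ∨ oF d).card = (S.filter oP).card + (S.filter oF).card := by
      rw [filter_or, card_union_of_disjoint]
      exact disjoint_filter.2 fun d hd h1 h2 => hexcl d (hS hd) ⟨h1, h2⟩
    have h3 : (S.filter fun d => ¬ (oP d ∨ oF d)) = S.filter vc :=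
      filter_congr fun d hd => (hvc_iff d (hS hd)).symm
    rw [h2, h3] at h1
    omega
  -- (2) registered contacts ↔ occupied caps (double counts)
  have hregP : ((NP.filter fun p => ∃ d ∈ U, c < ⟪p - q, d⟫_ℝ).card : ℤ) = (U.filter oP).card := by
    have := card_filter_exists_comm NP U (fun p d => c < ⟪p - q, d⟫_ℝ)
      (fun p hp d hd d' hd' h1 h2 => frameDir_unique c hc3 (hNPX p hp).2 (hU1 d hd) (hU1 d' hd')
        (fun hne => hUsep d hd d' hd' hne) h1 h2)
      (fun d hd p hp p' hp' h1 h2 => capPartner_unique X hX (hNPX p hp).1 (hNPX p' hp').1 (hNPX p hp).2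
        (hNPX p' hp').2 (hU1 d hd) (lt_of_le_of_lt hc3 h1) (lt_of_le_of_lt hc3 h2))
    exact_mod_cast this
  have hregF : ((NF.filter fun x => ∃ d ∈ U, c < ⟪x - q, d⟫_ℝ).card : ℤ) = (U.filter oF).card := by
    have := card_filter_exists_comm NF U (fun x d => c < ⟪x - q, d⟫_ℝ)
      (fun x hx d hd d' hd' h1 h2 => frameDir_unique c hc3 (hNFX x hx).2 (hU1 d hd) (hU1 d' hd')
        (fun hne => hUsep d hd d' hd' hne) h1 h2)
      (fun d hd x hx x' hx' h1 h2 => capPartner_unique X hX (hNFX x hx).1 (hNFX x' hx').1 (hNFX x hx).2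
        (hNFX x' hx').2 (hU1 d hd) (lt_of_le_of_lt hc3 h1) (lt_of_le_of_lt hc3 h2))
    exact_mod_cast this
  -- restricted to the down-caps and the up-caps
  set Dn := U.filter fun d => ⟪d, ν⟫_ℝ < 0 with hDn
  set Up := U.filter fun d => 0 < ⟪d, ν⟫_ℝ with hUp
  set Lv := U.filter fun d => ⟪d, ν⟫_ℝ = 0 with hLv
  have hDnU : Dn ⊆ U := filter_subset _ _
  have hUpU : Up ⊆ U := filter_subset _ _
  have hLvU : Lv ⊆ U := filter_subset _ _
  have hregFDn : ((NF.filter fun x => ∃ d ∈ U, ⟪d, ν⟫_ℝ < 0 ∧ c < ⟪x - q, d⟫_ℝ).card : ℤ) =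
      (Dn.filter oF).card := by
    have := card_filter_exists_comm NF Dn (fun x d => c < ⟪x - q, d⟫_ℝ)
      (fun x hx d hd d' hd' h1 h2 => frameDir_unique c hc3 (hNFX x hx).2 (hU1 d (hDnU hd)) (hU1 d' (hDnU hd'))
        (fun hne => hUsep d (hDnU hd) d' (hDnU hd') hne) h1 h2)
      (fun d hd x hx x' hx' h1 h2 => capPartner_unique X hX (hNFX x hx).1 (hNFX x' hx').1 (hNFX x hx).2
        (hNFX x' hx').2 (hU1 d (hDnU hd)) (lt_of_le_of_lt hc3 h1) (lt_of_le_of_lt hc3 h2))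
    have e : (NF.filter fun x => ∃ d ∈ U, ⟪d, ν⟫_ℝ < 0 ∧ c < ⟪x - q, d⟫_ℝ) =
        NF.filter fun x => ∃ d ∈ Dn, c < ⟪x - q, d⟫_ℝ := by
      refine filter_congr fun x _ => ?_
      simp only [hDn, mem_filter, and_assoc]
    rw [e]; exact_mod_cast this
  have hregFUp : ((NF.filter fun x => ∃ d ∈ U, 0 < ⟪d, ν⟫_ℝ ∧ c < ⟪x - q, d⟫_ℝ).card : ℤ) =
      (Up.filter oF).card := by
    have := card_filter_exists_comm NF Up (fun x d => c < ⟪x - q, d⟫_ℝ)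
      (fun x hx d hd d' hd' h1 h2 => frameDir_unique c hc3 (hNFX x hx).2 (hU1 d (hUpU hd)) (hU1 d' (hUpU hd'))
        (fun hne => hUsep d (hUpU hd) d' (hUpU hd') hne) h1 h2)
      (fun d hd x hx x' hx' h1 h2 => capPartner_unique X hX (hNFX x hx).1 (hNFX x' hx').1 (hNFX x hx).2
        (hNFX x' hx').2 (hU1 d (hUpU hd)) (lt_of_le_of_lt hc3 h1) (lt_of_le_of_lt hc3 h2))
    have e : (NF.filter fun x => ∃ d ∈ U, 0 < ⟪d, ν⟫_ℝ ∧ c < ⟪x - q, d⟫_ℝ) =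
        NF.filter fun x => ∃ d ∈ Up, c < ⟪x - q, d⟫_ℝ := by
      refine filter_congr fun x _ => ?_
      simp only [hUp, mem_filter, and_assoc]
    rw [e]; exact_mod_cast this
  -- (3) partitions of `U` by the sign of `⟪d, ν⟫`
  have hUsplit : ∀ (R : EuclideanSpace ℝ (Fin 3) → Prop) [DecidablePred R],
      ((U.filter R).card : ℤ) = (Dn.filter R).card + (Up.filter R).card + (Lv.filter R).card := by
    intro R _
    have h1 := card_filter_add_card_filter_not (s := U.filter R) (fun d => ⟪d, ν⟫_ℝ < 0)
    have h2 := card_filter_add_card_filter_not (s := (U.filter R).filter fun d => ¬ ⟪d, ν⟫_ℝ < 0)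
      (fun d => 0 < ⟪d, ν⟫_ℝ)
    have e1 : (U.filter R).filter (fun d => ⟪d, ν⟫_ℝ < 0) = Dn.filter R := by
      ext d; simp only [hDn, mem_filter]
      constructor
      · rintro ⟨⟨h1, h2⟩, h3⟩; exact ⟨⟨h1, h3⟩, h2⟩
      · rintro ⟨⟨h1, h3⟩, h2⟩; exact ⟨⟨h1, h2⟩, h3⟩
    have e2 : ((U.filter R).filter fun d => ¬ ⟪d, ν⟫_ℝ < 0).filter (fun d => 0 < ⟪d, ν⟫_ℝ) = Up.filter R := by
      ext d; simp only [hUp, mem_filter]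
      constructor
      · rintro ⟨⟨⟨h1, h2⟩, _⟩, h4⟩; exact ⟨⟨h1, h4⟩, h2⟩
      · rintro ⟨⟨h1, h4⟩, h2⟩; exact ⟨⟨⟨h1, h2⟩, not_lt.2 h4.le⟩, h4⟩
    have e3 : ((U.filter R).filter fun d => ¬ ⟪d, ν⟫_ℝ < 0).filter (fun d => ¬ 0 < ⟪d, ν⟫_ℝ) = Lv.filter R := by
      ext d; simp only [hLv, mem_filter]
      constructor
      · rintro ⟨⟨⟨h1, h2⟩, h3⟩, h4⟩; exact ⟨⟨h1, le_antisymm (not_lt.1 h4) (not_lt.1 h3)⟩, h2⟩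
      · rintro ⟨⟨h1, h4⟩, h2⟩; exact ⟨⟨⟨h1, h2⟩, by rw [h4]; exact lt_irrefl 0⟩, by rw [h4]; exact lt_irrefl 0⟩
    rw [e1] at h1; rw [e2, e3] at h2
    omega
  -- `#Up = #Dn` by negation
  have hUpDn : Up.card = Dn.card := by
    refine card_bij (fun d _ => -d) (fun d hd => ?_) (fun d _ d' _ h => neg_inj.1 h) (fun d hd => ?_)
    · obtain ⟨hdU, hdν⟩ := mem_filter.1 hd
      exact mem_filter.2 ⟨hUneg d hdU, by rw [inner_neg_left]; linarith⟩
    · obtain ⟨hdU, hdν⟩ := mem_filter.1 hd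
      exact ⟨-d, mem_filter.2 ⟨hUneg d hdU, by rw [inner_neg_left]; linarith⟩, neg_neg d⟩
  -- (4) registered / interstitial splits of the contacts
  have hsplitP : (NP.card : ℤ) = (NP.filter fun p => ∃ d ∈ U, c < ⟪p - q, d⟫_ℝ).card +
      (NP.filter fun p => ∀ d ∈ U, ⟪p - q, d⟫_ℝ ≤ c).card := by
    have h := card_filter_add_card_filter_not (s := NP) (fun p => ∃ d ∈ U, c < ⟪p - q, d⟫_ℝ)
    have e : (NP.filter fun p => ¬ ∃ d ∈ U, c < ⟪p - q, d⟫_ℝ) = NP.filter fun p => ∀ d ∈ U, ⟪p - q, d⟫_ℝ ≤ c := by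
      refine filter_congr fun p _ => ?_
      simp only [not_exists, not_and, not_lt]
    rw [e] at h; omega
  have hsplitF : (NF.card : ℤ) = (NF.filter fun x => ∃ d ∈ U, c < ⟪x - q, d⟫_ℝ).card +
      (NF.filter fun x => ∀ d ∈ U, ⟪x - q, d⟫_ℝ ≤ c).card := by
    have h := card_filter_add_card_filter_not (s := NF) (fun x => ∃ d ∈ U, c < ⟪x - q, d⟫_ℝ)
    have e : (NF.filter fun x => ¬ ∃ d ∈ U, c < ⟪x - q, d⟫_ℝ) = NF.filter fun x => ∀ d ∈ U, ⟪x - q, d⟫_ℝ ≤ c := by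
      refine filter_congr fun x _ => ?_
      simp only [not_exists, not_and, not_lt]
    rw [e] at h; omega
  -- interstitial film contacts by height
  have hintF : ((NF.filter fun x => ∀ d ∈ U, ⟪x - q, d⟫_ℝ ≤ c).card : ℤ) =
      (NF.filter fun x => (∀ d ∈ U, ⟪x - q, d⟫_ℝ ≤ c) ∧ ⟪x, ν⟫_ℝ < ⟪q, ν⟫_ℝ).card +
      (NF.filter fun x => (∀ d ∈ U, ⟪x - q, d⟫_ℝ ≤ c) ∧ ⟪q, ν⟫_ℝ < ⟪x, ν⟫_ℝ).card +
      (NF.filter fun x => (∀ d ∈ U, ⟪x - q, d⟫_ℝ ≤ c) ∧ ⟪x, ν⟫_ℝ = ⟪q, ν⟫_ℝ).card := by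
    simp only [card_filter, Nat.cast_sum, Nat.cast_ite, Nat.cast_one, Nat.cast_zero, ← sum_add_distrib]
    refine sum_congr rfl fun x _ => ?_
    by_cases h : ∀ d ∈ U, ⟪x - q, d⟫_ℝ ≤ c
    · rcases lt_trichotomy ⟪x, ν⟫_ℝ ⟪q, ν⟫_ℝ with hlt | heq | hgt
      · rw [if_pos h, if_pos ⟨h, hlt⟩, if_neg fun h' => (not_lt.2 hlt.le) h'.2, if_neg fun h' => hlt.ne h'.2]
        norm_num
      · rw [if_pos h, if_neg fun h' => (lt_irrefl _) (heq ▸ h'.2), if_neg fun h' => (lt_irrefl _) (heq ▸ h'.2),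
          if_pos ⟨h, heq⟩]
        norm_num
      · rw [if_pos h, if_neg fun h' => (not_lt.2 hgt.le) h'.2, if_pos ⟨h, hgt⟩, if_neg fun h' => hgt.ne' h'.2]
        norm_num
    · rw [if_neg h, if_neg fun h' => h h'.1, if_neg fun h' => h h'.1, if_neg fun h' => h h'.1]
      norm_num
  -- (5) the transfer sum
  have hsym_int : ∀ x, (∀ d ∈ U, ⟪q - x, d⟫_ℝ ≤ c) ↔ (∀ d ∈ U, ⟪x - q, d⟫_ℝ ≤ c) := by
    intro x
    constructor
    · intro h d hd
      have := h (-d) (hUneg d hd)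
      rwa [inner_neg_right, ← inner_neg_left, neg_sub] at this
    · intro h d hd
      have := h (-d) (hUneg d hd)
      rwa [inner_neg_right, ← inner_neg_left, neg_sub] at this
  have hsym_dn : ∀ x, (∃ d ∈ U, ⟪d, ν⟫_ℝ < 0 ∧ c < ⟪q - x, d⟫_ℝ) ↔ (∃ d ∈ U, 0 < ⟪d, ν⟫_ℝ ∧ c < ⟪x - q, d⟫_ℝ) := by
    intro x
    constructor
    · rintro ⟨d, hd, hdν, hdx⟩
      refine ⟨-d, hUneg d hd, by rw [inner_neg_left]; linarith, ?_⟩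
      rwa [inner_neg_right, ← inner_neg_left, neg_sub]
    · rintro ⟨d, hd, hdν, hdx⟩
      refine ⟨-d, hUneg d hd, by rw [inner_neg_left]; linarith, ?_⟩
      rwa [inner_neg_right, ← inner_neg_left, neg_sub]
  have hsum : ∑ x ∈ NF,
      (((if ∃ d ∈ U, ⟪d, ν⟫_ℝ < 0 ∧ c < ⟪x - q, d⟫_ℝ then (1 : ℤ) else 0)
        + (if (∀ d ∈ U, ⟪x - q, d⟫_ℝ ≤ c) ∧ ⟪x, ν⟫_ℝ < ⟪q, ν⟫_ℝ then (1 : ℤ) else 0))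
      - ((if ∃ d ∈ U, ⟪d, ν⟫_ℝ < 0 ∧ c < ⟪q - x, d⟫_ℝ then (1 : ℤ) else 0)
        + (if (∀ d ∈ U, ⟪q - x, d⟫_ℝ ≤ c) ∧ ⟪q, ν⟫_ℝ < ⟪x, ν⟫_ℝ then (1 : ℤ) else 0))) =
      ((NF.filter fun x => ∃ d ∈ U, ⟪d, ν⟫_ℝ < 0 ∧ c < ⟪x - q, d⟫_ℝ).card : ℤ)
      + (NF.filter fun x => (∀ d ∈ U, ⟪x - q, d⟫_ℝ ≤ c) ∧ ⟪x, ν⟫_ℝ < ⟪q, ν⟫_ℝ).card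
      - (NF.filter fun x => ∃ d ∈ U, 0 < ⟪d, ν⟫_ℝ ∧ c < ⟪x - q, d⟫_ℝ).card
      - (NF.filter fun x => (∀ d ∈ U, ⟪x - q, d⟫_ℝ ≤ c) ∧ ⟪q, ν⟫_ℝ < ⟪x, ν⟫_ℝ).card := by
    have e1 : ∀ x ∈ NF, (if ∃ d ∈ U, ⟪d, ν⟫_ℝ < 0 ∧ c < ⟪q - x, d⟫_ℝ then (1 : ℤ) else 0) =
        (if ∃ d ∈ U, 0 < ⟪d, ν⟫_ℝ ∧ c < ⟪x - q, d⟫_ℝ then (1 : ℤ) else 0) := fun x _ => by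
      rw [if_congr (hsym_dn x) rfl rfl]
    have e2 : ∀ x ∈ NF, (if (∀ d ∈ U, ⟪q - x, d⟫_ℝ ≤ c) ∧ ⟪q, ν⟫_ℝ < ⟪x, ν⟫_ℝ then (1 : ℤ) else 0) =
        (if (∀ d ∈ U, ⟪x - q, d⟫_ℝ ≤ c) ∧ ⟪q, ν⟫_ℝ < ⟪x, ν⟫_ℝ then (1 : ℤ) else 0) := fun x _ => by
      rw [if_congr (and_congr (hsym_int x) Iff.rfl) rfl rfl]
    rw [sum_congr rfl fun x hx => by rw [e1 x hx, e2 x hx]]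
    simp only [sum_sub_distrib, sum_add_distrib, card_filter, Nat.cast_sum, Nat.cast_ite, Nat.cast_one,
      Nat.cast_zero]
    ring
  -- (6) vacancy filters in the statement are the `vc` filters
  have hvD : (U.filter fun d => ⟪d, ν⟫_ℝ < 0 ∧ ∀ x ∈ X, dist q x = 1 → ⟪x - q, d⟫_ℝ ≤ c) = Dn.filter vc := by
    rw [hDn, filter_filter]
  have hvL : (U.filter fun d => ⟪d, ν⟫_ℝ = 0 ∧ ∀ x ∈ X, dist q x = 1 → ⟪x - q, d⟫_ℝ ≤ c) = Lv.filter vc := by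
    rw [hLv, filter_filter]
  -- assemble
  have sU := hsplit U (Subset.refl _)
  have sDn := hsplit Dn hDnU
  have sUp := hsplit Up hUpU
  have sLv := hsplit Lv hLvU
  have pP := hUsplit oP
  have pF := hUsplit oF
  have pV := hUsplit vc
  have hUD : (Up.card : ℤ) = Dn.card := by exact_mod_cast hUpDn
  have r1 : (P.filter fun p => dist q p = 1 ∧ ∀ d ∈ U, ⟪p - q, d⟫_ℝ ≤ c) =
      NP.filter fun p => ∀ d ∈ U, ⟪p - q, d⟫_ℝ ≤ c := by rw [hNP, filter_filter]
  have r2 : ((X \ P).filter fun x => dist q x = 1 ∧ (∀ d ∈ U, ⟪x - q, d⟫_ℝ ≤ c) ∧ ⟪x, ν⟫_ℝ < ⟪q, ν⟫_ℝ) =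
      NF.filter fun x => (∀ d ∈ U, ⟪x - q, d⟫_ℝ ≤ c) ∧ ⟪x, ν⟫_ℝ < ⟪q, ν⟫_ℝ := by rw [hNF, filter_filter]
  have r3 : ((X \ P).filter fun x => dist q x = 1 ∧ (∀ d ∈ U, ⟪x - q, d⟫_ℝ ≤ c) ∧ ⟪x, ν⟫_ℝ = ⟪q, ν⟫_ℝ) =
      NF.filter fun x => (∀ d ∈ U, ⟪x - q, d⟫_ℝ ≤ c) ∧ ⟪x, ν⟫_ℝ = ⟪q, ν⟫_ℝ := by rw [hNF, filter_filter]
  have r5 : (U.filter fun d => 0 < ⟪d, ν⟫_ℝ ∧ ∃ p ∈ P, dist q p = 1 ∧ c < ⟪p - q, d⟫_ℝ) = Up.filter oP := by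
    rw [hUp, filter_filter]
    refine filter_congr fun d _ => and_congr Iff.rfl ?_
    simp only [hoP, hNP, mem_filter, and_assoc]
  have r6 : (U.filter fun d => ⟪d, ν⟫_ℝ = 0 ∧ ∃ p ∈ P, dist q p = 1 ∧ c < ⟪p - q, d⟫_ℝ) = Lv.filter oP := by
    rw [hLv, filter_filter]
    refine filter_congr fun d _ => and_congr Iff.rfl ?_
    simp only [hoP, hNP, mem_filter, and_assoc]
  rw [r1, r2, r3, r5, r6, hsum, hvD, hvL, hregFDn, hregFUp]
  rw [hregP] at hsplitP
  rw [hregF, hintF] at hsplitF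
  linarith [sU, sDn, sUp, sLv, pP, pF, pV, hUD, hsplitP, hsplitF]

end Summit.Ventures.Crystal3D.Theorems

end
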